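import Summits.QuantumFields.YangMills.Theorems.LuscherReductionRunningReductionInnerCopies
import HarnessLib

/-!
# The physical (gauge- and twist-invariant) extension of a slow scalar off the window: `m̃ = 1 + twistSum(𝟙_{orbitDist<δ₁}·(m − 1))` equals `m` on `{orbitDist < δ₁}` (`L·δ₁ < 2`)
# (route `FlatTubeReduction`, crux K1 `NearFlatRatioLaw` stmt-QuantumFields-24720; seat `ym-line-ftr-p1` g14; rate twin «ratepack-v3 / frozen fibres»; R2b1 RECORD rung — no summit
# statement is proved here)

WHY (memo `Cruxes/NearFlatRatioLaw/Lines/ratepack-v3-frozen-g12.md` §8.2).  The normalised dressing of the rate twin is `clampW κ (f̂/m̂) (min(d_tor,½))` with `m̂(u) = mass(u)/mass(1)`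
(`…DressedWeightNormalised.dressedWeight_fields_normalised`), which asks `m̂` to be measurable, gauge AND centre-twist invariant for every `β`; the fibre mass is gauge (colour) invariant but
not twist invariant (the fat-tube indicator is not).  Only the window `{orbitDist < δ₁}` matters, and the eight twisted copies of the window are pairwise disjoint (`twist3_eq_of_orbitDist_lt`,
`L·δ₁ < 2`), so the twist symmetrisation of `𝟙_{window}·(m − 1)` (RED's `twistSum`, `isPhys_twistSum`) is a physical function that agrees with `m − 1` on the window.
* `twistSum_eq_self_of_orbitDist_lt` — a function supported in `{orbitDist < δ}` equals its twist symmetrisation there;  ★★ `exists_phys_extension`.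
HONEST FRAMING: symmetry bookkeeping; femto rung R2b1 (RECORD label); not infinite volume, not a gap, not Clay.  No defs, no named facts, no `sorry`.
-/

set_option autoImplicit false

noncomputable section

open MeasureTheory Filter Topology Real
open scoped BigOperators
open Literature.MathematicalPhysics.QuantumFieldTheory
open Literature.MathematicalPhysics.QuantumLattice

namespace Summit.QuantumFields.YangMills.Theorems.FemtoTransferGap.RateTube

open Summit.QuantumFields.YangMills.Theorems.FemtoTransferGap

variable {L : ℕ} [NeZero L]

/-- A function supported in `{orbitDist < δ}` (`L·δ < 2`) equals its twist symmetrisation on `{orbitDist < δ}`: the other seven copies vanish there. [folklore] -/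
theorem twistSum_eq_self_of_orbitDist_lt {φ : GaugeConfig 3 L SU2 → ℝ} {δ : ℝ} (hLδ : (L : ℝ) * δ < 2) (hφ : ∀ U, φ U ≠ 0 → orbitDist U < δ)
    {U : GaugeConfig 3 L SU2} (hU : orbitDist U < δ) : twistSum φ U = φ U := by
  unfold twistSum
  rw [Finset.sum_eq_single (fun _ : Fin 3 => false) (fun z _ hz => ?_) (fun h => absurd (Finset.mem_univ _) h), TT.twist3_false]
  by_contra hne
  have h0 : orbitDist (TT.twist3 (fun _ : Fin 3 => false) U) < δ := by rw [TT.twist3_false]; exact hU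
  exact hz (twist3_eq_of_orbitDist_lt hLδ (hφ _ hne) h0)

/-- ★★ **PHYSICAL EXTENSION OFF THE WINDOW.**  `m_β` measurable and gauge invariant for every `β`, window radii `L·δ₁(β) < 2`.  Then
`m̃_β := 1 + twistSum(u ↦ 𝟙{orbitDist u < δ₁ β}·(m_β u − 1))` is measurable, gauge invariant, centre-twist invariant, equals `m_β` on `{orbitDist < δ₁ β}`, and
`|m_β − 1| ≤ C` (`C ≥ 0`) on the window ⇒ `|m̃_β − 1| ≤ 8C` everywhere. [cite: Luscher1983, §2] -/
theorem exists_phys_extension {m : ℝ → GaugeConfig 3 L SU2 → ℝ} (hmm : ∀ β, Measurable (m β))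
    (hmg : ∀ β (g : Site 3 L → SU2) (U : GaugeConfig 3 L SU2), m β (gaugeTransform g U) = m β U) {δ₁ : ℝ → ℝ} (hδ : ∀ β, (L : ℝ) * δ₁ β < 2) :
    ∃ mt : ℝ → GaugeConfig 3 L SU2 → ℝ, (∀ β, Measurable (mt β)) ∧ (∀ β (g : Site 3 L → SU2) (U : GaugeConfig 3 L SU2), mt β (gaugeTransform g U) = mt β U) ∧
      (∀ β (k : Fin 3), ∀ z ∈ Subgroup.center SU2, ∀ U : GaugeConfig 3 L SU2, mt β (twist k z U) = mt β U) ∧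
      (∀ β (U : GaugeConfig 3 L SU2), orbitDist U < δ₁ β → mt β U = m β U) ∧
      (∀ β (C : ℝ), 0 ≤ C → (∀ U, orbitDist U < δ₁ β → |m β U - 1| ≤ C) → ∀ U, |mt β U - 1| ≤ 8 * C) := by
  -- the window-cut deviation `φ_β = 𝟙{orbitDist < δ₁ β}·(m_β − 1)`
  obtain ⟨φ, hφdef⟩ : ∃ φ : ℝ → GaugeConfig 3 L SU2 → ℝ, φ = fun β U => if orbitDist U < δ₁ β then m β U - 1 else 0 := ⟨_, rfl⟩
  have hφm : ∀ β, Measurable (φ β) := fun β => by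
    rw [hφdef]; exact Measurable.ite (measurableSet_lt measurable_orbitDist measurable_const) ((hmm β).sub measurable_const) measurable_const
  have hφg : ∀ β (g : Site 3 L → SU2) (U : GaugeConfig 3 L SU2), φ β (gaugeTransform g U) = φ β U := fun β g U => by
    simp only [hφdef, orbitDist_gaugeTransform, hmg]
  have hφs : ∀ β U, φ β U ≠ 0 → orbitDist U < δ₁ β := fun β U h => by
    by_contra hn; rw [hφdef] at h; simp only [hn, if_false, ne_eq, not_true_eq_false] at h
  have hφw : ∀ β U, orbitDist U < δ₁ β → φ β U = m β U - 1 := fun β U hU => by simp only [hφdef, hU, if_true]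
  refine ⟨fun β U => 1 + twistSum (φ β) U, fun β => measurable_const.add (measurable_twistSum (hφm β)),
    fun β g U => by dsimp only; rw [twistSum_gaugeTransform (hφg β)],
    fun β k z hz U => by dsimp only; rw [twistSum_twist (φ β) k hz], fun β U hU => ?_, fun β C hC0 hC U => ?_⟩
  · dsimp only; rw [twistSum_eq_self_of_orbitDist_lt (hδ β) (hφs β) hU, hφw β U hU]; ring
  · have hb : ∀ V, |φ β V| ≤ C := fun V => by
      by_cases hV : orbitDist V < δ₁ β
      · rw [hφw β V hV]; exact hC V hV
      · have : φ β V = 0 := by rw [hφdef]; simp only [hV, if_false]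
        rw [this, abs_zero]; exact hC0
    dsimp only; rw [add_sub_cancel_left]; exact abs_twistSum_le hb U

end Summit.QuantumFields.YangMills.Theorems.FemtoTransferGap.RateTube

end
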